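import Literature.NumberTheory.EllipticCurves.PadicWeierstrassZetaProofs
import Literature.NumberTheory.EllipticCurves.PadicSigmaVariableChangeProofs
import Literature.RingTheory.FormalGroups.FunctionalEquationIntegrality
import Mathlib.AlgebraicGeometry.EllipticCurve.Reduction
import HarnessLib

/-!
# From the `p`-adic Weierstrass zeta function to the sigma function: `σ = z · exp ∫ ζ̃ ω`
# (Blakestad–Grant 2023, §2.2; Mazur–Stein–Tate 2006, Thm. 1.3 — the ODE half)

Trunk T-NT-EC (Literature/NumberTheory/EllipticCurves). The tree has

* the zeta side (`PadicWeierstrassZetaProofs`, Blakestad–Grant Thm. 2): a constant `β` and a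
  series `Λ = 1 + ⋯` with `zΛ' - Λ = -(X - βz²)·ω` (`X = z²x`, `ω = W(z)dz`), i.e. `Dζ = -x + β`
  for `ζ = Λ/z`;
* the sigma side (`PadicSigma`): the Mazur–Tate equation `x + c = -D(Dσ/σ)` in the pole-cleared
  form `SatisfiesSigmaODE W σ c : ω·(X + cz²) = g - z g'` with `g = (s + zs')(ωs)⁻¹`, `s = σ/z`
  (`sigmaG`, `sigmaShift` of `PadicSigmaUniquenessProofs`).

This file links them over an arbitrary commutative `ℚ`-algebra `K` (Blakestad–Grant §2.2:
"`ζ̃ = ζ - Dt/t`, `g(t) = ∫ ζ̃ ω`, `σ̃ = exp(g)`, `σ = tσ̃`, and by construction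
`ζ = D(log σ) = (dσ/ω)/σ`"):

* `Literature.NumberTheory.EllipticCurves.formalPrimitive H = ∫₀ H` and
  `WeierstrassCurve.sigmaExpArg W Λ = ∫ (Λω - 1)/z` (`= ∫ ζ̃ω`, Blakestad–Grant's `g`),
  `WeierstrassCurve.sigmaOfZeta W Λ = z · exp(sigmaExpArg W Λ)` (their `σ = t·σ̃`);
* `X_mul_formalInvariantDerivation_sigmaOfZeta` — **`z·Dσ = Λ·σ`**, i.e. `Dσ/σ = ζ`;
  `sigmaG_sigmaOfZeta` — the tree's `g` of `σ` IS `Λ`;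
* `satisfiesSigmaODE_of_X_mul_D_eq` — **if `z·Dσ = Λσ`, `σ = z + ⋯`, and
  `zΛ' - Λ = -(X - βz²)ω`, then `SatisfiesSigmaODE W σ (-β)`** (so the Mazur–Tate constant is
  `c = -β`); `satisfiesSigmaODE_sigmaOfZeta` — in particular for `σ = sigmaOfZeta W Λ`;
  conversely `X_mul_derivative_sigmaG_sub_of_satisfiesSigmaODE`: a solution of the sigma ODE
  gives back a zeta series `Λ = g` (with `β = -c`);
* parity (`a₁ = a₃ = 0`): `rescale_neg_one_sigmaOfZeta`, `isFormallyOdd_sigmaOfZeta` — if `Λ`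
  is even then `σ` is odd (Blakestad–Grant: "`g` … is even", "`σ(t)` … odd"), and
  `rescale_neg_one_eq_self_of_zetaSeries` — a zeta series with `[z¹]Λ = 0` is even;
* `coeff_sigmaOfZeta_mem` — `σ ∈ A⟦z⟧` as soon as `exp(∫ζ̃ω) ∈ A⟦z⟧` (the conclusion of
  Hazewinkel's functional equation lemma, `Literature.RingTheory.FormalGroups`, Cor. 6(c), in
  Blakestad–Grant's proof of Thm. 1).

So, for the existence half of the tree's named fact `WeierstrassCurve.mazur_tate_sigma_existsUnique`
along Blakestad–Grant, what remains after this file is exactly the integrality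
`exp(sigmaExpArg) ∈ R̂⟦z⟧` (their Thm. 1 via Prop. 13(b) and Cor. 6(c): the canonical `p`-isogeny).

## Sources

* C. Blakestad, D. Grant, J. Number Theory 249 (2023) (arXiv:1903.02480), §2.2 (first three
  displays: `ζ̃`, `g = ∫ζ̃ω`, `σ̃ = exp g`, `σ = tσ̃`, `ζ = D(log σ)`), Thm. 1, Thm. 2.
  [BlakestadGrant2023]
* B. Mazur, W. Stein, J. Tate, Doc. Math. Extra Vol. Coates (2006), Thm. 1.3
  (`x(t) + c = -(d/ω)(σ⁻¹ dσ/ω)`), §3.1. [MazurSteinTate2006]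

## Design notes

Three definitions (`formalPrimitive`, `sigmaExpArg`, `sigmaOfZeta`), no named facts. Everything
is over a commutative `ℚ`-algebra (`formalOmega`, `exp`, `∫` need denominators); coefficient
rings enter only through `coeff_sigmaOfZeta_mem`.
-/

noncomputable section

open PowerSeries Literature.NumberTheory.EllipticCurves Literature.RingTheory.FormalGroups

namespace Literature.NumberTheory.EllipticCurves

/-! ### Formal primitives and parity over a `ℚ`-algebra -/

section Primitive

variable {K : Type*} [CommRing K] [Algebra ℚ K]

/-- **The formal primitive `∫₀ᶻ H`**: `Σ hₙ zⁿ ↦ Σ hₙ zⁿ⁺¹/(n+1)` (no constant term).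
[folklore] -/
def formalPrimitive (H : K⟦X⟧) : K⟦X⟧ :=
  PowerSeries.mk fun n => if n = 0 then 0 else algebraMap ℚ K (1 / (n : ℚ)) * coeff (n - 1) H

/-- `(∫H)(0) = 0`. [folklore] -/
@[simp] theorem constantCoeff_formalPrimitive (H : K⟦X⟧) : constantCoeff (formalPrimitive H) = 0 := by
  rw [← coeff_zero_eq_constantCoeff_apply, formalPrimitive, coeff_mk, if_pos rfl]

/-- `[zⁿ⁺¹] ∫H = hₙ/(n+1)`. [folklore] -/
theorem coeff_succ_formalPrimitive (H : K⟦X⟧) (n : ℕ) :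
    coeff (n + 1) (formalPrimitive H) = algebraMap ℚ K (1 / ((n + 1 : ℕ) : ℚ)) * coeff n H := by
  rw [formalPrimitive, coeff_mk, if_neg (Nat.succ_ne_zero n), Nat.succ_sub_one]

/-- **`(∫H)' = H`.** [folklore] -/
theorem derivative_formalPrimitive (H : K⟦X⟧) : d⁄dX K (formalPrimitive H) = H := by
  ext n
  rw [coeff_derivative, coeff_succ_formalPrimitive]
  have h : algebraMap ℚ K (1 / ((n + 1 : ℕ) : ℚ)) * ((n : K) + 1) = 1 := by
    rw [show ((n : K) + 1) = algebraMap ℚ K ((n + 1 : ℕ) : ℚ) by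
      rw [map_natCast]; push_cast; rfl, ← map_mul, one_div,
      inv_mul_cancel₀ (by exact_mod_cast Nat.succ_ne_zero n), map_one]
  linear_combination coeff n H * h

/-- A series is even (`f(-z) = f(z)`) iff its odd coefficients vanish (torsion-free
coefficients). [folklore] -/
theorem rescale_neg_one_eq_self_iff {R : Type*} [CommRing R] [IsAddTorsionFree R] (f : R⟦X⟧) :
    rescale (-1 : R) f = f ↔ ∀ n, Odd n → coeff n f = 0 := by
  refine ⟨fun h n hn => coeff_eq_zero_of_rescale_neg_one_eq_self h hn, fun h => ?_⟩
  ext n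
  rw [coeff_rescale]
  rcases Nat.even_or_odd n with he | ho
  · rw [he.neg_one_pow, one_mul]
  · rw [h n ho, mul_zero]

/-- A series is odd (`f(-z) = -f(z)`) iff its even coefficients vanish (torsion-free
coefficients). [folklore] -/
theorem rescale_neg_one_eq_neg_iff {R : Type*} [CommRing R] [IsAddTorsionFree R] (f : R⟦X⟧) :
    rescale (-1 : R) f = -f ↔ ∀ n, Even n → coeff n f = 0 := by
  refine ⟨fun h n hn => coeff_eq_zero_of_rescale_neg_one_eq_neg h hn, fun h => ?_⟩
  ext n
  rw [coeff_rescale, map_neg]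
  rcases Nat.even_or_odd n with he | ho
  · rw [h n he, mul_zero, neg_zero]
  · rw [ho.neg_one_pow, neg_one_mul]

/-- The primitive of an odd series is even. [folklore] -/
theorem rescale_neg_one_formalPrimitive_of_odd {H : K⟦X⟧} (hH : rescale (-1 : K) H = -H) :
    rescale (-1 : K) (formalPrimitive H) = formalPrimitive H := by
  haveI := IsAddTorsionFree.of_module_rat (M := K)
  rw [rescale_neg_one_eq_neg_iff] at hH
  rw [rescale_neg_one_eq_self_iff]
  intro n hn
  obtain ⟨m, rfl⟩ : ∃ m, n = m + 1 := ⟨n - 1, by obtain ⟨k, rfl⟩ := hn; omega⟩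
  rw [coeff_succ_formalPrimitive, hH m (by obtain ⟨k, hk⟩ := hn; exact ⟨k, by omega⟩), mul_zero]

/-- `exp` of an even series (without constant term) is even: `exp(G)(-z) = exp(G(-z))`.
[folklore] -/
theorem rescale_neg_one_exp_subst {G : K⟦X⟧} (hG0 : constantCoeff G = 0)
    (hG : rescale (-1 : K) G = G) : rescale (-1 : K) ((exp K).subst G) = (exp K).subst G := by
  have hX : constantCoeff (-X : K⟦X⟧) = 0 := by rw [map_neg, constantCoeff_X, neg_zero]
  rw [← subst_neg_X_eq_rescale, exp_subst_subst hG0 hX, subst_neg_X_eq_rescale, hG]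

end Primitive

end Literature.NumberTheory.EllipticCurves

namespace WeierstrassCurve

variable {K : Type*} [CommRing K] [Algebra ℚ K] (W : WeierstrassCurve K)

/-! ### `g = ∫ ζ̃ ω` and `σ = z · exp g` -/

/-- **Blakestad–Grant's `g = ∫ ζ̃ω`** for a zeta series `Λ = zζ`: since
`ζ̃ω = (ζ - Dz/z)ω = (Λ/z - 1/(zW))·W dz = (ΛW - 1) dz/z`, it is the formal primitive of
`(Λ·W - 1)/z` (`W = ω/dz = formalOmega`; the division by `z` is exact when `Λ(0) = 1`).
[Blakestad–Grant 2023, §2.2 (`g(t) = ∫ ζ̃_{E/R̂}(t)ω`)] [cite: BlakestadGrant2023, Thm. 1] -/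
def sigmaExpArg (Λ : K⟦X⟧) : K⟦X⟧ :=
  formalPrimitive (PowerSeries.mk fun n => coeff (n + 1) (Λ * W.formalOmega - 1))

/-- **Blakestad–Grant's `σ = t · exp(g)`**, the sigma function attached to a zeta series `Λ`
(`ζ = Λ/z`): `σ = z · exp(∫ (ΛW - 1)/z)`, so that `Dσ/σ = ζ`. [Blakestad–Grant 2023, §2.2
(`σ̃(t) = exp(g(t))`, `σ(t) = tσ̃(t)`)] [cite: BlakestadGrant2023, Thm. 1] -/
def sigmaOfZeta (Λ : K⟦X⟧) : K⟦X⟧ :=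
  X * (exp K).subst (W.sigmaExpArg Λ)

variable {W}

/-- `g(0) = 0`. [folklore] -/
@[simp] theorem constantCoeff_sigmaExpArg (Λ : K⟦X⟧) : constantCoeff (W.sigmaExpArg Λ) = 0 :=
  constantCoeff_formalPrimitive _

/-- **`z · g' = ΛW - 1`** (`g' = ζ̃ W`) when `Λ(0) = 1`. [Blakestad–Grant 2023, §2.2] [folklore] -/
theorem X_mul_derivative_sigmaExpArg {Λ : K⟦X⟧} (h0 : constantCoeff Λ = 1) :
    X * d⁄dX K (W.sigmaExpArg Λ) = Λ * W.formalOmega - 1 := by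
  rw [sigmaExpArg, derivative_formalPrimitive]
  have h : constantCoeff (Λ * W.formalOmega - 1) = 0 := by
    rw [map_sub, map_mul, h0, W.constantCoeff_formalOmega, map_one, mul_one, sub_self]
  conv_rhs => rw [eq_X_mul_shift_add_const (Λ * W.formalOmega - 1), h, map_zero, add_zero]

/-- `σ(0) = 0`. [folklore] -/
@[simp] theorem constantCoeff_sigmaOfZeta (Λ : K⟦X⟧) : constantCoeff (W.sigmaOfZeta Λ) = 0 := by
  rw [sigmaOfZeta, map_mul, constantCoeff_X, zero_mul]

/-- `σ = z + O(z²)`. [Blakestad–Grant 2023, Thm. 1 ("with lead term `t`")] [folklore] -/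
@[simp] theorem coeff_one_sigmaOfZeta (Λ : K⟦X⟧) : coeff 1 (W.sigmaOfZeta Λ) = 1 := by
  rw [sigmaOfZeta, coeff_succ_X_mul, coeff_zero_eq_constantCoeff_apply,
    constantCoeff_exp_subst (constantCoeff_sigmaExpArg Λ)]

/-- `σ/z = exp(g)`: the shift of `σ`. [folklore] -/
theorem sigmaShift_sigmaOfZeta (Λ : K⟦X⟧) :
    sigmaShift (W.sigmaOfZeta Λ) = (exp K).subst (W.sigmaExpArg Λ) := by
  ext n
  rw [coeff_sigmaShift, sigmaOfZeta, coeff_succ_X_mul]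

/-- **`z · Dσ = Λ · σ`**, i.e. `Dσ/σ = ζ = Λ/z` (`D = d/ω = η·d/dz`): "by construction,
`ζ_{E/R̂}(t) = D(log σ(t)) = (dσ(t)/ω)/σ(t)`". [Blakestad–Grant 2023, §2.2]
[cite: BlakestadGrant2023, Thm. 1] -/
theorem X_mul_formalInvariantDerivation_sigmaOfZeta {Λ : K⟦X⟧} (h0 : constantCoeff Λ = 1) :
    X * W.formalInvariantDerivation (W.sigmaOfZeta Λ) = Λ * W.sigmaOfZeta Λ := by
  have hG0 : constantCoeff (W.sigmaExpArg Λ) = 0 := constantCoeff_sigmaExpArg Λ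
  have hs' := derivative_exp_subst hG0
  have hXG := X_mul_derivative_sigmaExpArg (W := W) h0
  have hηω := W.formalEta_mul_formalOmega
  rw [sigmaOfZeta, formalInvariantDerivation_apply, Derivation.leibniz, derivative_X, hs',
    smul_eq_mul, smul_eq_mul, mul_one]
  set s := (exp K).subst (W.sigmaExpArg Λ)
  linear_combination (X * W.formalEta * s) * hXG + (X * s * Λ) * hηω

/-- **The tree's `g` of `σ = sigmaOfZeta Λ` is `Λ`**: `(s + zs')(ωs)⁻¹ = Λ` for `s = σ/z = exp g`.
[Mazur–Stein–Tate 2006, Thm. 1.3; Blakestad–Grant 2023, §2.2] [folklore] -/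
theorem sigmaG_sigmaOfZeta {Λ : K⟦X⟧} (h0 : constantCoeff Λ = 1) :
    W.sigmaG (W.sigmaOfZeta Λ) = Λ := by
  have h1 : coeff 1 (W.sigmaOfZeta Λ) = 1 := coeff_one_sigmaOfZeta Λ
  have hmul := W.sigmaG_mul h1
  have hG0 : constantCoeff (W.sigmaExpArg Λ) = 0 := constantCoeff_sigmaExpArg Λ
  have hs' := derivative_exp_subst hG0
  have hXG := X_mul_derivative_sigmaExpArg (W := W) h0
  -- `s + zs' = s(1 + zG') = s·Λ·ω`
  have hkey : sigmaShift (W.sigmaOfZeta Λ) + X * d⁄dX K (sigmaShift (W.sigmaOfZeta Λ)) =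
      Λ * (W.formalOmega * sigmaShift (W.sigmaOfZeta Λ)) := by
    rw [sigmaShift_sigmaOfZeta, hs']
    linear_combination ((exp K).subst (W.sigmaExpArg Λ)) * hXG
  have hunit : IsUnit (W.formalOmega * sigmaShift (W.sigmaOfZeta Λ)) := by
    refine isUnit_iff_constantCoeff.mpr ?_
    rw [W.constantCoeff_formalOmega_mul_sigmaShift h1]; exact isUnit_one
  rw [hkey] at hmul
  exact hunit.mul_right_cancel hmul

/-! ### The sigma ODE from `zDσ = Λσ` and the zeta equation -/

/-- **From zeta to sigma.** Over a `ℚ`-algebra, if `σ = z + ⋯` satisfies `z·Dσ = Λ·σ`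
(`Dσ/σ = ζ`) and `Λ = zζ` is a zeta series with constant `β`, `zΛ' - Λ = -(X - βz²)·ω`
(`Dζ = -x + β`, Blakestad–Grant Thm. 2), then `σ` satisfies the Mazur–Tate equation
`x - β = -D(Dσ/σ)`, i.e. `SatisfiesSigmaODE W σ (-β)`: **the Mazur–Tate constant is `c = -β`.**
[Blakestad–Grant 2023, Thm. 1 and §2.2; Mazur–Stein–Tate 2006, Thm. 1.3]
[cite: BlakestadGrant2023, Thm. 1] -/
theorem satisfiesSigmaODE_of_X_mul_D_eq {σ Λ : K⟦X⟧} {β : K} (hσ0 : constantCoeff σ = 0)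
    (hσ1 : coeff 1 σ = 1) (hD : X * W.formalInvariantDerivation σ = Λ * σ)
    (hΛ : X * d⁄dX K Λ - Λ = -((W.formalXMulSq - C β * X ^ 2) * W.formalOmega)) :
    W.SatisfiesSigmaODE σ (-β) := by
  -- `g = Λ`
  have hXs : X * sigmaShift σ = σ := X_mul_sigmaShift hσ0
  set s := sigmaShift σ with hs
  have hη : W.formalEta * (s + X * d⁄dX K s) = Λ * s := by
    have h := hD
    rw [← hXs, formalInvariantDerivation_apply, Derivation.leibniz, derivative_X, smul_eq_mul,
      smul_eq_mul, mul_one] at h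
    apply PowerSeries.X_mul_cancel
    linear_combination h
  have hkey : s + X * d⁄dX K s = Λ * (W.formalOmega * s) := by
    have hωη := W.formalOmega_mul_formalEta
    linear_combination W.formalOmega * hη - (s + X * d⁄dX K s) * hωη
  have hunit : IsUnit (W.formalOmega * s) := by
    refine isUnit_iff_constantCoeff.mpr ?_
    rw [hs, W.constantCoeff_formalOmega_mul_sigmaShift hσ1]; exact isUnit_one
  have hg : W.sigmaG σ = Λ := by
    have hmul := W.sigmaG_mul hσ1
    rw [← hs, hkey] at hmul
    exact hunit.mul_right_cancel hmul
  rw [satisfiesSigmaODE_iff, hg, map_neg]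
  linear_combination hΛ

/-- **`σ = sigmaOfZeta Λ` satisfies the Mazur–Tate equation with constant `-β`.**
[Blakestad–Grant 2023, Thm. 1; Mazur–Stein–Tate 2006, Thm. 1.3] [cite: BlakestadGrant2023, Thm. 1] -/
theorem satisfiesSigmaODE_sigmaOfZeta {Λ : K⟦X⟧} {β : K} (h0 : constantCoeff Λ = 1)
    (hΛ : X * d⁄dX K Λ - Λ = -((W.formalXMulSq - C β * X ^ 2) * W.formalOmega)) :
    W.SatisfiesSigmaODE (W.sigmaOfZeta Λ) (-β) :=
  satisfiesSigmaODE_of_X_mul_D_eq (constantCoeff_sigmaOfZeta Λ) (coeff_one_sigmaOfZeta Λ)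
    (X_mul_formalInvariantDerivation_sigmaOfZeta h0) hΛ

/-- **Conversely, from sigma to zeta**: a solution `σ = z + ⋯` of `SatisfiesSigmaODE W σ c`
yields the zeta series `Λ := g = zDσ/σ` with `Λ(0) = 1` and `zΛ' - Λ = -(X - (-c)z²)·ω`
(`Dζ = -x - c` for `ζ = Dσ/σ`). [Mazur–Stein–Tate 2006, Thm. 1.3; Blakestad–Grant 2023, Thm. 2]
[folklore] -/
theorem X_mul_derivative_sigmaG_sub_of_satisfiesSigmaODE {σ : K⟦X⟧} {c : K} (hσ1 : coeff 1 σ = 1)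
    (h : W.SatisfiesSigmaODE σ c) :
    constantCoeff (W.sigmaG σ) = 1 ∧
      X * d⁄dX K (W.sigmaG σ) - W.sigmaG σ = -((W.formalXMulSq - C (-c) * X ^ 2) * W.formalOmega) := by
  refine ⟨W.constantCoeff_sigmaG hσ1, ?_⟩
  rw [satisfiesSigmaODE_iff] at h
  rw [map_neg]
  linear_combination h

/-! ### Parity: an even zeta series gives an odd sigma function (`a₁ = a₃ = 0`) -/

/-- **Normalising `ζ` to be odd**: over torsion-free coefficients, a zeta series
`zΛ' - Λ = -Φ` with `Φ` even and `[z¹]Λ = 0` is even (the coefficients `[zⁿ]Λ`, `n ≥ 2`, are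
`-[zⁿ]Φ/(n-1)`; `[z¹]Λ` — the constant term of `ζ` — is free, and Blakestad–Grant fix it by
oddness of `ζ`). [Blakestad–Grant 2023, Thm. 2 ("we can make `ζ(t)` unique by specifying that it is
odd")] [folklore] -/
theorem _root_.Literature.NumberTheory.EllipticCurves.rescale_neg_one_eq_self_of_zetaSeries
    {R : Type*} [CommRing R] [IsAddTorsionFree R] {Λ Φ : R⟦X⟧} (hΛ : X * d⁄dX R Λ - Λ = -Φ)
    (hΦ : rescale (-1 : R) Φ = Φ) (h1 : coeff 1 Λ = 0) : rescale (-1 : R) Λ = Λ := by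
  rw [rescale_neg_one_eq_self_iff] at hΦ ⊢
  intro n hn
  obtain ⟨m, rfl⟩ : ∃ m, n = m + 1 := ⟨n - 1, by obtain ⟨k, rfl⟩ := hn; omega⟩
  rcases Nat.eq_zero_or_pos m with rfl | hm
  · exact h1
  · have h := congrArg (coeff (m + 1)) hΛ
    rw [map_sub, coeff_succ_X_mul, coeff_derivative, map_neg, hΦ _ hn, neg_zero] at h
    have h' : (m : R) * coeff (m + 1) Λ = 0 := by linear_combination h
    have h'' : m • coeff (m + 1) Λ = 0 := by rwa [nsmul_eq_mul]
    exact (nsmul_eq_zero_iff.mp h'').resolve_right hm.ne'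

/-- A zeta series can be normalised to `[z¹]Λ = 0` without changing its equation
(`z(cz)' - cz = 0`). [folklore] -/
theorem _root_.Literature.NumberTheory.EllipticCurves.zetaSeries_sub_C_mul_X {R : Type*} [CommRing R]
    {Λ Φ : R⟦X⟧} (hΛ : X * d⁄dX R Λ - Λ = -Φ) (c : R) :
    X * d⁄dX R (Λ - C c * X) - (Λ - C c * X) = -Φ ∧ constantCoeff (Λ - C c * X) = constantCoeff Λ := by
  constructor
  · rw [map_sub, Derivation.leibniz, derivative_X, derivative_C, smul_zero, add_zero, smul_eq_mul,
      mul_one]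
    linear_combination hΛ
  · rw [map_sub, map_mul, constantCoeff_C, constantCoeff_X, mul_zero, sub_zero]

variable [W.IsCharNeTwoNF]

/-- **`σ(-z) = -σ(z)` for an even zeta series** (`a₁ = a₃ = 0`, so `ω` is even, `g = ∫ζ̃ω` is
even and `σ = z·exp g` is odd). [Blakestad–Grant 2023, §2.2 ("`g(t)` … is even in `t`";
"`σ(t) = tσ̃(t)`, which is an odd power series in `t`")] [cite: BlakestadGrant2023, Thm. 1] -/
theorem rescale_neg_one_sigmaOfZeta {Λ : K⟦X⟧} (hev : rescale (-1 : K) Λ = Λ) :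
    rescale (-1 : K) (W.sigmaOfZeta Λ) = -W.sigmaOfZeta Λ := by
  haveI := IsAddTorsionFree.of_module_rat (M := K)
  -- `ΛW - 1` is even, so `(ΛW - 1)/z` is odd and `g` is even
  have hΦ : rescale (-1 : K) (Λ * W.formalOmega - 1) = Λ * W.formalOmega - 1 := by
    rw [map_sub, map_mul, hev, W.rescale_neg_one_formalOmega, map_one]
  have hH : rescale (-1 : K) (PowerSeries.mk fun n => coeff (n + 1) (Λ * W.formalOmega - 1)) =
      -(PowerSeries.mk fun n => coeff (n + 1) (Λ * W.formalOmega - 1)) := by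
    rw [rescale_neg_one_eq_self_iff] at hΦ
    rw [rescale_neg_one_eq_neg_iff]
    intro n hn
    rw [coeff_mk]
    exact hΦ (n + 1) (by obtain ⟨k, rfl⟩ := hn; exact ⟨k, by ring⟩)
  have hG : rescale (-1 : K) (W.sigmaExpArg Λ) = W.sigmaExpArg Λ :=
    rescale_neg_one_formalPrimitive_of_odd hH
  rw [sigmaOfZeta, map_mul, rescale_X, rescale_neg_one_exp_subst (constantCoeff_sigmaExpArg Λ) hG,
    map_neg, map_one]
  ring

/-- **Mazur–Tate oddness of `σ = sigmaOfZeta Λ`** for an even zeta series on a model with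
`a₁ = a₃ = 0`: `σ(i(z)) = -σ(z)` (`i(z) = -z` here). [Blakestad–Grant 2023, Thm. 1 ("odd under
`t → -t`"); Mazur–Stein–Tate 2006, Thm. 1.3 ("odd function")] [cite: BlakestadGrant2023, Thm. 1] -/
theorem isFormallyOdd_sigmaOfZeta {Λ : K⟦X⟧} (hev : rescale (-1 : K) Λ = Λ) :
    W.IsFormallyOdd (W.sigmaOfZeta Λ) :=
  W.isFormallyOdd_iff_rescale_of_isCharNeTwoNF.mpr (rescale_neg_one_sigmaOfZeta hev)

omit [W.IsCharNeTwoNF] in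
/-- **Integrality is that of `exp(g)`**: if `exp(∫ζ̃ω)` has coefficients in a subring `A` then so
does `σ = z·exp(∫ζ̃ω)` — the form in which Blakestad–Grant's Thm. 1 concludes ("`σ̃(t)` — and
hence `σ(t)` — has coefficients in `R̂`", from Cor. 6(c)). [Blakestad–Grant 2023, proof of Thm. 1]
[folklore] -/
theorem coeff_sigmaOfZeta_mem (A : Subring K) {Λ : K⟦X⟧}
    (h : ∀ n, coeff n ((exp K).subst (W.sigmaExpArg Λ)) ∈ A) (n : ℕ) :
    coeff n (W.sigmaOfZeta Λ) ∈ A := by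
  rcases n with _ | n
  · rw [coeff_zero_eq_constantCoeff, constantCoeff_sigmaOfZeta]; exact A.zero_mem
  · rw [sigmaOfZeta, coeff_succ_X_mul]; exact h n

/-! ### Over `ℤ_p ⊂ ℚ_p`: the Mazur–Tate pair, up to the integrality of `exp(∫ζ̃ω)` -/

section PadicInt

omit [Algebra ℚ K] in
/-- `(X - βz²)·W` is even for `a₁ = a₃ = 0`. [Blakestad–Grant 2023, proof of Prop. 3(c)]
[folklore] -/
theorem rescale_neg_one_formalXMulSq_sub_mul_formalInvDiff (β : K) :
    rescale (-1 : K) ((W.formalXMulSq - C β * X ^ 2) * W.formalInvDiff) =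
      (W.formalXMulSq - C β * X ^ 2) * W.formalInvDiff := by
  have hX2 : rescale (-1 : K) ((X : K⟦X⟧) ^ 2) = X ^ 2 := by
    have h := rescale_neg_one_X_pow_two_mul (R := K) 1
    rwa [mul_one] at h
  rw [map_mul, map_sub, map_mul, rescale_C_eq, hX2, W.rescale_neg_one_formalXMulSq,
    W.rescale_neg_one_formalInvDiff]

variable {p : ℕ} [Fact p.Prime]

/-- **The Mazur–Tate pair of an ordinary curve over `ℤ_p`, granted the integrality of
`exp(∫ζ̃ω)`.** Let `W₀/ℤ_p` have `a₁ = a₃ = 0` and `V = W₀ ⊗ ℚ_p`; let `β ∈ ℤ_p` and an EVEN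
zeta series `Λ = 1 + ⋯ ∈ ℤ_p⟦z⟧` with `zΛ' - Λ = -(X - βz²)W` be given (Blakestad–Grant Thm. 2,
`PadicWeierstrassZetaProofs`). If `exp(g)`, `g = ∫ζ̃ω = sigmaExpArg V Λ`, has `p`-integral
coefficients (the conclusion of Blakestad–Grant's Thm. 1 via Cor. 6(c)), then
`(σ, c) = (z·exp g, -β)` is a Mazur–Tate sigma pair of `V` in the sense of the tree
(`IsMazurTateSigmaPair`: `σ ∈ ℤ_p⟦z⟧`, `σ = z + ⋯`, odd, `x + c = -D(Dσ/σ)`, `c ∈ ℤ_p`).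
[Blakestad–Grant 2023, Thm. 1, Thm. 15; Mazur–Stein–Tate 2006, Thm. 1.3]
[cite: BlakestadGrant2023, Thm. 1] -/
theorem isMazurTateSigmaPair_sigmaOfZeta (V : WeierstrassCurve ℚ_[p]) [V.IsCharNeTwoNF]
    (W₀ : WeierstrassCurve ℤ_[p]) (hV : W₀.map (algebraMap ℤ_[p] ℚ_[p]) = V)
    {β : ℤ_[p]} {Λ : ℤ_[p]⟦X⟧} (h0 : constantCoeff Λ = 1) (hev : rescale (-1 : ℤ_[p]) Λ = Λ)
    (hΛ : X * d⁄dX ℤ_[p] Λ - Λ = -((W₀.formalXMulSq - C β * X ^ 2) * W₀.formalInvDiff))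
    (hint : ∀ n, ‖coeff n ((exp ℚ_[p]).subst
      (V.sigmaExpArg (Λ.map (algebraMap ℤ_[p] ℚ_[p]))))‖ ≤ 1) :
    V.IsMazurTateSigmaPair (V.sigmaOfZeta (Λ.map (algebraMap ℤ_[p] ℚ_[p]))) (-(β : ℚ_[p])) := by
  set ι : ℤ_[p] →+* ℚ_[p] := algebraMap ℤ_[p] ℚ_[p] with hι
  set Λ' := Λ.map ι with hΛ'
  have h0' : constantCoeff Λ' = 1 := by
    rw [hΛ', ← coeff_zero_eq_constantCoeff_apply, coeff_map, coeff_zero_eq_constantCoeff_apply, h0,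
      map_one]
  have hev' : rescale (-1 : ℚ_[p]) Λ' = Λ' := by
    rw [hΛ', show (-1 : ℚ_[p]) = ι (-1) by rw [map_neg, map_one], rescale_map, hev]
  have hΛ'eq : X * d⁄dX ℚ_[p] Λ' - Λ' = -((V.formalXMulSq - C (β : ℚ_[p]) * X ^ 2) * V.formalOmega) := by
    have h := congrArg (PowerSeries.map ι) hΛ
    rw [map_sub, map_mul, map_X, ← derivative_map, map_neg, map_mul, map_sub, map_mul, map_C, map_pow,
      map_X, W₀.map_formalXMulSq ι, W₀.map_formalInvDiff ι, hV, V.formalInvDiff_eq_formalOmega] at h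
    exact h
  refine ⟨constantCoeff_sigmaOfZeta Λ', coeff_one_sigmaOfZeta Λ', fun n => ?_, ?_,
    isFormallyOdd_sigmaOfZeta hev', satisfiesSigmaODE_sigmaOfZeta h0' hΛ'eq⟩
  · exact (PadicInt.mem_subring_iff p).mp
      (coeff_sigmaOfZeta_mem (PadicInt.subring p) (fun m => (PadicInt.mem_subring_iff p).mpr (hint m)) n)
  · rw [norm_neg]; exact PadicInt.norm_le_one β

/-- **The zeta data of an integral ordinary short model over `ℚ_p`** (`p` odd): for
`V = W₀ ⊗ ℚ_p` with `a₁ = a₃ = 0` and unit Hasse coefficient `‖w_{p-1}‖ = 1` there are `β ∈ ℤ_p`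
and an even zeta series `Λ = 1 + ⋯ ∈ ℤ_p⟦z⟧`, `zΛ' - Λ = -(X - βz²)W` — Blakestad–Grant's Thm. 2
over `ℤ_p` (`PadicWeierstrassZetaProofs`), normalised by oddness of `ζ = Λ/z`.
[Blakestad–Grant 2023, Thm. 2] [cite: BlakestadGrant2023, Thm. 2] -/
theorem exists_even_zetaSeries (hp2 : p ≠ 2) (W₀ : WeierstrassCurve ℤ_[p]) [W₀.IsCharNeTwoNF]
    (hA : IsUnit (coeff (p - 1) W₀.formalInvDiff)) :
    ∃ β : ℤ_[p], ∃ Λ : ℤ_[p]⟦X⟧, constantCoeff Λ = 1 ∧ rescale (-1 : ℤ_[p]) Λ = Λ ∧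
      X * d⁄dX ℤ_[p] Λ - Λ = -((W₀.formalXMulSq - C β * X ^ 2) * W₀.formalInvDiff) := by
  haveI := padicInt_isAdicComplete_span_p p
  have hw := W₀.isUnit_coeff_formalInvDiff_prime_pow_sub_one p hp2 hA
  obtain ⟨β, hβ⟩ := W₀.exists_padicWeierstrassZetaConst p hp2 hw
  obtain ⟨Λ₀, h0, hΛ₀, -⟩ := W₀.exists_padicWeierstrassZetaSeries hβ
  obtain ⟨hΛ₁, h0₁⟩ := zetaSeries_sub_C_mul_X hΛ₀ (coeff 1 Λ₀)
  refine ⟨β, Λ₀ - C (coeff 1 Λ₀) * X, by rw [h0₁, h0], ?_, hΛ₁⟩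
  refine rescale_neg_one_eq_self_of_zetaSeries hΛ₁
    (W₀.rescale_neg_one_formalXMulSq_sub_mul_formalInvDiff β) ?_
  rw [map_sub, coeff_C_mul, coeff_one_X, mul_one, sub_self]

/-- **Reduction of the tree's named fact `mazur_tate_sigma_existsUnique` (Mazur–Stein–Tate 2006,
Thm. 1.3) to Blakestad–Grant's integrality theorem in its sharpest form**: it suffices that for
every short Weierstrass model `W₀/ℤ_p` (`p ≥ 5`) with unit discriminant and unit Hasse
coefficient `w_{p-1}`, and every even zeta series `Λ` of `W₀` (Thm. 2), the series
`exp(∫ζ̃ω) = exp(sigmaExpArg (W₀ ⊗ ℚ_p) Λ)` has `p`-integral coefficients (Blakestad–Grant's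
Thm. 1, proved by them via the canonical `p`-isogeny, Prop. 13(b), and Hazewinkel's functional
equation lemma, Cor. 6(c) — the latter in the tree as
`Literature.RingTheory.FormalGroups.coeff_exp_subst_mem_of_functionalEquation_subst`). The zeta
data exist (`exists_even_zetaSeries`), the resulting `σ = z·exp(∫ζ̃ω)` is then a Mazur–Tate pair
of the short model (`isMazurTateSigmaPair_sigmaOfZeta`), and the tree's
`mazur_tate_sigma_existsUnique_of_exists_shortModel` (transport to the minimal model, uniqueness)
concludes. [Blakestad–Grant 2023, Thm. 1, Thm. 2, Thm. 15; Mazur–Stein–Tate 2006, Thm. 1.3]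
[cite: MazurSteinTate2006, Thm. 1.3] -/
theorem mazur_tate_sigma_existsUnique_of_exp_sigmaExpArg_integral
    (hint : ∀ (p : ℕ) [Fact p.Prime] (W₀ : WeierstrassCurve ℤ_[p]) [W₀.IsShortNF], 5 ≤ p →
      IsUnit W₀.Δ → IsUnit (coeff (p - 1) W₀.formalInvDiff) →
      ∀ (β : ℤ_[p]) (Λ : ℤ_[p]⟦X⟧), constantCoeff Λ = 1 → rescale (-1 : ℤ_[p]) Λ = Λ →
        X * d⁄dX ℤ_[p] Λ - Λ = -((W₀.formalXMulSq - C β * X ^ 2) * W₀.formalInvDiff) →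
        ∀ n, ‖coeff n ((exp ℚ_[p]).subst ((W₀.map (algebraMap ℤ_[p] ℚ_[p])).sigmaExpArg
          (Λ.map (algebraMap ℤ_[p] ℚ_[p]))))‖ ≤ 1) :
    mazur_tate_sigma_existsUnique := by
  refine mazur_tate_sigma_existsUnique_of_exists_shortModel fun p _ V _ _ hp hΔ hc => ?_
  -- an integral short model `W₀/ℤ_p` of `V`
  set W₀ : WeierstrassCurve ℤ_[p] := integralModel ℤ_[p] V with hW₀
  have hV : W₀.map (algebraMap ℤ_[p] ℚ_[p]) = V := baseChange_integralModel_eq ℤ_[p] V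
  have hinj : Function.Injective (algebraMap ℤ_[p] ℚ_[p]) := IsFractionRing.injective ℤ_[p] ℚ_[p]
  haveI : W₀.IsShortNF := by
    refine ⟨hinj ?_, hinj ?_, hinj ?_⟩
    · rw [map_zero, ← map_a₁, hV, V.a₁_of_isShortNF]
    · rw [map_zero, ← map_a₂, hV, V.a₂_of_isShortNF]
    · rw [map_zero, ← map_a₃, hV, V.a₃_of_isShortNF]
  have hp2 : p ≠ 2 := by omega
  -- the hypotheses of `hint`, read over `ℤ_p`
  have hΔ₀ : IsUnit W₀.Δ := by
    rw [PadicInt.isUnit_iff, PadicInt.norm_def, show ((W₀.Δ : ℤ_[p]) : ℚ_[p]) = V.Δ by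
      rw [← hV, map_Δ]; rfl]
    exact hΔ
  have hcoe : coeff (p - 1) V.formalOmega = ((coeff (p - 1) W₀.formalInvDiff : ℤ_[p]) : ℚ_[p]) := by
    rw [← V.formalInvDiff_eq_formalOmega, ← hV, ← W₀.map_formalInvDiff, coeff_map]; rfl
  have hA : IsUnit (coeff (p - 1) W₀.formalInvDiff) := by
    rw [PadicInt.isUnit_iff, PadicInt.norm_def, ← hcoe]; exact hc
  obtain ⟨β, Λ, h0, hev, hΛ⟩ := exists_even_zetaSeries hp2 W₀ hA
  refine ⟨_, _, isMazurTateSigmaPair_sigmaOfZeta V W₀ hV h0 hev hΛ ?_⟩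
  have h := hint p W₀ hp hΔ₀ hA β Λ h0 hev hΛ
  rwa [hV] at h

end PadicInt

end WeierstrassCurve
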